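import Mathlib
import HarnessLib
import Summits.NavierStokesRegularity.NavierStokesRegularity.Theorems.PoloidalWindowDoorPoloidalWindowRigidityZShockAutonomyPropagation

/-!
# Crux K2 `PoloidalWindowRigidity` (stmt-NavierStokesRegularity-19708), line `z_shock` — IN A THICK WINDOW THE (TH)-INSTANTS ARE ISOLATED

`--supports stmt-NavierStokesRegularity-19708 --as helper` (leafhand-ns-poloidalwindowdoor-2 g0, 2026-08-31).  **No stub and no summit is
closed by this file; Navier–Stokes regularity is NOT proved here.**

Named danger located while typing the R3 entrance (`…ZShockGenuineNonlinearity`): the stubs' THICK clause («no `(t, x₂)`-slope function on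
any open sub-window») is a SPACE–TIME property, so genuine nonlinearity of the slope function (`G' ≠ 0`) is witnessed at SOME time of every
sub-window, not necessarily at the densely hyperbolic time `t₀ = z₀.1` of `stub_zShockThickAut`: a single slice may be a «(TH)-instant»
(its common slope `Λ(t,·)` constant on the window section, i.e. linearly degenerate there).  This file bounds that danger by joint
real-analyticity IN TIME: on a product sub-window `I × B ⊆ W` the set of (TH)-instants `{t ∈ I : Λ(t,·) is constant on B}` is either all of
`I` — excluded by thickness — or has NO accumulation point in `I` (identity theorem in the time variable, for each pair of points of `B`).

* `constant_slices_all_of_frequently` — class-free core: `t ↦ Λ(t,x)` analytic on a preconnected `I` for every `x ∈ B`; if the slices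
  `Λ(s,·)` are constant on `B` for `s` FREQUENTLY near some `t ∈ I` (punctured), then they are constant on `B` for ALL `s ∈ I`;
* `analyticOnNhd_time_fderiv_slice` — for a jointly analytic `v` on the slab, every slice-derivative entry `t ↦ ∂_u v_i(t, x)` is
  real-analytic in `t` on `(−∞, 0)` (fixed `x`);
* `th_instants_isolated_of_class` — **class entry**: class binders of the stubs (Type-I rate, continuity, Oseen identity, divergence-free,
  poloidal), a window `W` with `∇ₕv₂ ≠ 0` which is THICK, and a product sub-window `ball t₀ δ × ball x₀ ρ ⊆ W` ⇒ for every time `t` of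
  `ball t₀ δ`, at all times `s ≠ t` close enough to `t` the slice `s` is NOT (TH) on the ball: there is no constant `c` with
  `∂_z v_b(s,x) = c·∂_b v₂(s,x)` for all `x ∈ ball x₀ ρ`, `b = 0, 1`.  (With `…ZShockGenuineNonlinearity`: at those times the analytic slope
  function of the ball has `G' ≠ 0` somewhere.)

So the densely hyperbolic time `t₀` of the deciding stub is either itself genuinely nonlinear on the ball or an ISOLATED exception with
genuinely nonlinear slices at all nearby times; whether dense hyperbolicity persists to those nearby times is NOT provided by the stub as
typed (planner-facing remark, recorded in the seat's census). [folklore]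
-/

noncomputable section

namespace Summit.NavierStokesRegularity.NavierStokesRegularity.Theorems.PoloidalWindowDoorPoloidalWindowRigidityZShockThickInstants

-- the problem directory repeats the summit name (`NavierStokesRegularity/NavierStokesRegularity`)
set_option linter.dupNamespace false

open Set Filter Topology Function Metric
open Literature.Analysis Literature.Analysis.FluidPDE
open Summit.NavierStokesRegularity.NavierStokesRegularity.Theorems.PoloidalWindowDoorPoloidalWindowRigidityLocalFrozenLaw
  (vertShear_wedge_horizGrad_eq_zero)
open Summit.NavierStokesRegularity.NavierStokesRegularity.Theorems.PoloidalWindowDoorPoloidalWindowRigidityWindow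
  (isTypeIAncientMild_of_class)

/-! ## Class-free core: identity theorem in the time variable -/

/-- **Frequently constant slices are always constant.**  Let `I ⊆ ℝ` be preconnected and `t ↦ Λ t x` real-analytic on `I` for every `x`
in a set `B ∋ x₀`.  If for `s` frequently in a punctured neighbourhood of some `t ∈ I` the slice `Λ s ·` is constant on `B`, then every
slice `Λ s ·`, `s ∈ I`, is constant on `B`. [folklore] -/
theorem constant_slices_all_of_frequently {X : Type*} {Λ : ℝ → X → ℝ} {I : Set ℝ} (hI : IsPreconnected I)
    {B : Set X} {x₀ : X} (han : ∀ x ∈ B, AnalyticOnNhd ℝ (fun t => Λ t x) I) {t : ℝ} (ht : t ∈ I)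
    (hfreq : ∃ᶠ s in 𝓝[≠] t, ∀ x ∈ B, Λ s x = Λ s x₀) (hx₀ : x₀ ∈ B) :
    ∀ s ∈ I, ∀ x ∈ B, Λ s x = Λ s x₀ := by
  intro s hs x hx
  have hh : AnalyticOnNhd ℝ (fun t => Λ t x - Λ t x₀) I := fun t ht => (han x hx t ht).sub (han x₀ hx₀ t ht)
  have hfz : ∃ᶠ s in 𝓝[≠] t, (fun t => Λ t x - Λ t x₀) s = 0 :=
    hfreq.mono fun s hs => by simp only [hs x hx, sub_self]
  have h := hh.eqOn_zero_of_preconnected_of_frequently_eq_zero hI ht hfz hs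
  simp only [Pi.zero_apply, sub_eq_zero] at h
  exact h

/-! ## Time-analyticity of slice derivatives -/

/-- **Slice-derivative entries are analytic in time.**  If `v` is jointly real-analytic on the open slab `(−∞,0) × ℝ³`, then for fixed
`x, u, i` the function `t ↦ ∂_u v_i(t, x) = D(v t)(x)[u]_i` is real-analytic on `(−∞, 0)`. [folklore] -/
theorem analyticOnNhd_time_fderiv_slice {v : ℝ → EuclideanSpace ℝ (Fin 3) → EuclideanSpace ℝ (Fin 3)}
    (hF : AnalyticOnNhd ℝ (Function.uncurry v) (Set.Iio (0 : ℝ) ×ˢ Set.univ))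
    (x u : EuclideanSpace ℝ (Fin 3)) (i : Fin 3) :
    AnalyticOnNhd ℝ (fun t => fderiv ℝ (v t) x u i) (Set.Iio 0) := by
  set S : Set (ℝ × EuclideanSpace ℝ (Fin 3)) := Set.Iio (0 : ℝ) ×ˢ Set.univ with hSdef
  have hS : IsOpen S := isOpen_Iio.prod isOpen_univ
  have hFd : AnalyticOnNhd ℝ (fderiv ℝ (Function.uncurry v)) S := hF.fderiv_of_isOpen hS
  -- `p ↦ D(uncurry v)(p)[(0,u)]_i` is analytic on the slab
  have hg : AnalyticOnNhd ℝ (fun p => fderiv ℝ (Function.uncurry v) p ((0 : ℝ), u) i) S := by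
    have h1 := ((EuclideanSpace.proj (𝕜 := ℝ) i).comp
      (ContinuousLinearMap.apply ℝ (EuclideanSpace ℝ (Fin 3)) (((0 : ℝ), u) : ℝ × EuclideanSpace ℝ (Fin 3)))).comp_analyticOnNhd hFd
    refine h1.congr hS fun p _ => ?_
    simp only [Function.comp_apply, ContinuousLinearMap.coe_comp, ContinuousLinearMap.apply_apply]
    rfl
  -- restrict along `t ↦ (t, x)`
  have hι : AnalyticOnNhd ℝ (fun t : ℝ => ((t, x) : ℝ × EuclideanSpace ℝ (Fin 3))) (Set.Iio 0) :=
    fun t _ => analyticAt_id.prod analyticAt_const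
  have hmaps : MapsTo (fun t : ℝ => ((t, x) : ℝ × EuclideanSpace ℝ (Fin 3))) (Set.Iio 0) S :=
    fun t ht => Set.mk_mem_prod ht (Set.mem_univ _)
  have hcomp := hg.comp hι hmaps
  refine hcomp.congr isOpen_Iio fun t ht => ?_
  -- `D(v t)(x)[u] = D(uncurry v)(t,x)[(0,u)]`
  have hFt : DifferentiableAt ℝ (Function.uncurry v) (t, x) := (hF (t, x) (hmaps ht)).differentiableAt
  have hchain : HasFDerivAt (fun y => Function.uncurry v (t, y))
      ((fderiv ℝ (Function.uncurry v) (t, x)).comp (ContinuousLinearMap.inr ℝ ℝ (EuclideanSpace ℝ (Fin 3)))) x :=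
    hFt.hasFDerivAt.comp x (hasFDerivAt_prodMk_right t x)
  have hvt : (fun y => Function.uncurry v (t, y)) = v t := rfl
  rw [hvt] at hchain
  simp only [Function.comp_apply, hchain.fderiv, ContinuousLinearMap.coe_comp, ContinuousLinearMap.inr_apply]

/-! ## Class entry -/

/-- **In a THICK window of a class profile, the (TH)-instants of every product sub-window are isolated.**  Class binders of the stubs
(Type-I rate, continuity on the slab, unit-viscosity Oseen identity, divergence-free, poloidal), a window `W` in the slab on which
`∇ₕv₂ ≠ 0` and which is THICK (no `(t, x₂)`-slope function on any open sub-window), and a product sub-window `ball t₀ δ × ball x₀ ρ ⊆ W`.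
Then for every `t ∈ ball t₀ δ`: for all `s ≠ t` sufficiently close to `t`, the slice `s` is NOT linearly degenerate on the ball — there is
no constant `c` with `∂_z v_b(s,x) = c·∂_b v₂(s,x)` for all `x ∈ ball x₀ ρ` and `b = 0, 1`.  Proof: the common slope
`Λ = (∂_z v₀∂₀v₂ + ∂_z v₁∂₁v₂)/|∇ₕv₂|²` is analytic in `t` at fixed `x` (joint analyticity of the class); if (TH)-instants accumulated at `t`,
`Λ(s,·)` would be constant on the ball for all `s` (identity theorem), and `m(s,·) := Λ(s,x₀)` would be a `(t,x₂)`-slope function on the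
sub-window (wedge law), contradicting thickness. [folklore] -/
theorem th_instants_isolated_of_class (C : ℝ) (v : ℝ → EuclideanSpace ℝ (Fin 3) → EuclideanSpace ℝ (Fin 3))
    (hrate : Literature.Analysis.FluidPDE.HasTypeITimeDecay C v)
    (hcont : ContinuousOn (Function.uncurry v) (Set.Iio (0 : ℝ) ×ˢ Set.univ))
    (hmild : ∀ s t : ℝ, s < t → t < 0 → ∀ x, v t x =
      Literature.Analysis.UnboundedOperators.heatExtension (v s) (t - s) x -
        Literature.Analysis.FluidPDE.oseenDuhamel 1 s v v t x)
    (hdiv : ∀ t < 0, Literature.Analysis.FluidPDE.VectorCalculus.IsDivFree (v t))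
    (hpol : ∀ s < 0, ∀ y, inner ℝ (Literature.Analysis.FluidPDE.curl (v s) y) (EuclideanSpace.single 2 1) = 0)
    {W : Set (ℝ × EuclideanSpace ℝ (Fin 3))} (hWs : W ⊆ Set.Iio (0 : ℝ) ×ˢ Set.univ)
    (hnd : ∀ z ∈ W, fderiv ℝ (v z.1) z.2 (EuclideanSpace.single 0 1) 2 ≠ 0 ∨
      fderiv ℝ (v z.1) z.2 (EuclideanSpace.single 1 1) 2 ≠ 0)
    (hthick : ∀ m : ℝ → ℝ → ℝ, ∀ W' : Set (ℝ × EuclideanSpace ℝ (Fin 3)), W' ⊆ W → IsOpen W' → W'.Nonempty →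
      ∃ z ∈ W', ∃ b : Fin 3, b ≠ 2 ∧
        fderiv ℝ (v z.1) z.2 (EuclideanSpace.single 2 1) b ≠
          m z.1 (z.2 2) * fderiv ℝ (v z.1) z.2 (EuclideanSpace.single b 1) 2)
    {t₀ : ℝ} {x₀ : EuclideanSpace ℝ (Fin 3)} {δ ρ : ℝ} (hδ : 0 < δ) (hρ : 0 < ρ)
    (hsub : ball t₀ δ ×ˢ ball x₀ ρ ⊆ W) {t : ℝ} (ht : t ∈ ball t₀ δ) :
    ∀ᶠ s in 𝓝[≠] t, ¬ ∃ c : ℝ, ∀ x ∈ ball x₀ ρ, ∀ b : Fin 3, b ≠ 2 →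
      fderiv ℝ (v s) x (EuclideanSpace.single 2 1) b = c * fderiv ℝ (v s) x (EuclideanSpace.single b 1) 2 := by
  -- shorthand for the slope data
  set N0 : ℝ → EuclideanSpace ℝ (Fin 3) → ℝ := fun s y => fderiv ℝ (v s) y (EuclideanSpace.single 2 1) 0 with hN0
  set N1 : ℝ → EuclideanSpace ℝ (Fin 3) → ℝ := fun s y => fderiv ℝ (v s) y (EuclideanSpace.single 2 1) 1 with hN1
  set D0 : ℝ → EuclideanSpace ℝ (Fin 3) → ℝ := fun s y => fderiv ℝ (v s) y (EuclideanSpace.single 0 1) 2 with hD0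
  set D1 : ℝ → EuclideanSpace ℝ (Fin 3) → ℝ := fun s y => fderiv ℝ (v s) y (EuclideanSpace.single 1 1) 2 with hD1
  set Λ : ℝ → EuclideanSpace ℝ (Fin 3) → ℝ := fun s y =>
    (N0 s y * D0 s y + N1 s y * D1 s y) / (D0 s y ^ 2 + D1 s y ^ 2) with hΛ
  have hI : ball t₀ δ ⊆ Set.Iio 0 := by
    intro s hs
    have h : (s, x₀) ∈ Set.Iio (0 : ℝ) ×ˢ (Set.univ : Set (EuclideanSpace ℝ (Fin 3))) :=
      hWs (hsub (Set.mk_mem_prod hs (mem_ball_self hρ)))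
    exact (Set.mem_prod.1 h).1
  have hpos : ∀ s ∈ ball t₀ δ, ∀ y ∈ ball x₀ ρ, D0 s y ^ 2 + D1 s y ^ 2 ≠ 0 := by
    intro s hs y hy
    rcases hnd (s, y) (hsub ⟨hs, hy⟩) with h | h
    · have : 0 < D0 s y ^ 2 := by positivity
      positivity
    · have : 0 < D1 s y ^ 2 := by positivity
      positivity
  -- joint analyticity ⇒ `Λ(·, y)` analytic in time on the time ball
  have hF : AnalyticOnNhd ℝ (Function.uncurry v) (Set.Iio (0 : ℝ) ×ˢ Set.univ) :=
    Literature.Analysis.NavierStokesZoomKit.LocalSineTubeDoorProfileAlignedWindowRigidityAncient.analyticOnNhd_uncurry hcont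
      (Literature.Analysis.NavierStokesZoomKit.LocalSineTubeDoorProfileAlignedWindowRigidityAncient.bdd_of_hasTypeITimeDecay hrate)
      hmild
  have hΛan : ∀ y ∈ ball x₀ ρ, AnalyticOnNhd ℝ (fun s => Λ s y) (ball t₀ δ) := by
    intro y hy s hs
    have hs0 : s ∈ Set.Iio (0 : ℝ) := hI hs
    have aN0 := analyticOnNhd_time_fderiv_slice hF y (EuclideanSpace.single 2 1) 0 s hs0
    have aN1 := analyticOnNhd_time_fderiv_slice hF y (EuclideanSpace.single 2 1) 1 s hs0
    have aD0 := analyticOnNhd_time_fderiv_slice hF y (EuclideanSpace.single 0 1) 2 s hs0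
    have aD1 := analyticOnNhd_time_fderiv_slice hF y (EuclideanSpace.single 1 1) 2 s hs0
    exact ((aN0.mul aD0).add (aN1.mul aD1)).div ((aD0.pow 2).add (aD1.pow 2)) (hpos s hs y hy)
  -- the wedge law on the slab
  obtain ⟨q, hq⟩ := exists_isClassicalNSSolutionOn_Iio_of_isTypeIAncientMild (isTypeIAncientMild_of_class hrate hcont hmild hdiv)
  have hslab : IsOpen (Set.Iio (0 : ℝ) ×ˢ (Set.univ : Set (EuclideanSpace ℝ (Fin 3)))) := isOpen_Iio.prod isOpen_univ
  have hpol' : ∀ p ∈ Set.Iio (0 : ℝ) ×ˢ (Set.univ : Set (EuclideanSpace ℝ (Fin 3))),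
      inner ℝ (curl (v p.1) p.2) (EuclideanSpace.single 2 (1 : ℝ)) = 0 :=
    fun p hp => hpol p.1 (Set.mem_prod.1 hp).1 p.2
  have hwedge : ∀ s ∈ ball t₀ δ, ∀ y : EuclideanSpace ℝ (Fin 3), N0 s y * D1 s y - N1 s y * D0 s y = 0 :=
    fun s hs y => vertShear_wedge_horizGrad_eq_zero hslab hq.onRegion hpol' (p := (s, y)) (Set.mk_mem_prod (hI hs) (Set.mem_univ y))
  -- `N_b = Λ D_b` on the sub-window (wedge law + non-degeneracy)
  have hNΛ : ∀ s ∈ ball t₀ δ, ∀ y ∈ ball x₀ ρ, N0 s y = Λ s y * D0 s y ∧ N1 s y = Λ s y * D1 s y := by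
    intro s hs y hy
    have hne := hpos s hs y hy
    have hw := hwedge s hs y
    have hsum : N0 s y * D0 s y + N1 s y * D1 s y = Λ s y * (D0 s y ^ 2 + D1 s y ^ 2) := by
      simp only [hΛ]; field_simp
    constructor
    · have key : N0 s y * (D0 s y ^ 2 + D1 s y ^ 2) = (Λ s y * D0 s y) * (D0 s y ^ 2 + D1 s y ^ 2) := by
        have : N0 s y * (D0 s y ^ 2 + D1 s y ^ 2) = (N0 s y * D0 s y + N1 s y * D1 s y) * D0 s y := by
          linear_combination D1 s y * hw
        rw [this, hsum]; ring
      exact mul_right_cancel₀ hne key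
    · have key : N1 s y * (D0 s y ^ 2 + D1 s y ^ 2) = (Λ s y * D1 s y) * (D0 s y ^ 2 + D1 s y ^ 2) := by
        have : N1 s y * (D0 s y ^ 2 + D1 s y ^ 2) = (N0 s y * D0 s y + N1 s y * D1 s y) * D1 s y := by
          linear_combination (-D0 s y) * hw
        rw [this, hsum]; ring
      exact mul_right_cancel₀ hne key
  -- a (TH)-instant `s` on the ball has `Λ(s,·) ≡ c` on the ball
  have hconst_of_TH : ∀ s ∈ ball t₀ δ, (∃ c : ℝ, ∀ x ∈ ball x₀ ρ, ∀ b : Fin 3, b ≠ 2 →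
      fderiv ℝ (v s) x (EuclideanSpace.single 2 1) b = c * fderiv ℝ (v s) x (EuclideanSpace.single b 1) 2) →
      ∀ x ∈ ball x₀ ρ, Λ s x = Λ s x₀ := by
    rintro s hs ⟨c, hc⟩ x hx
    have hΛc : ∀ y ∈ ball x₀ ρ, Λ s y = c := by
      intro y hy
      have h0 : N0 s y = c * D0 s y := hc y hy 0 (by decide)
      have h1 : N1 s y = c * D1 s y := hc y hy 1 (by decide)
      simp only [hΛ, h0, h1]
      field_simp [hpos s hs y hy]
    rw [hΛc x hx, hΛc x₀ (mem_ball_self hρ)]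
  -- contradiction with thickness if (TH)-instants accumulate at `t`
  by_contra hacc
  have hfreq : ∃ᶠ s in 𝓝[≠] t, ∃ c : ℝ, ∀ x ∈ ball x₀ ρ, ∀ b : Fin 3, b ≠ 2 →
      fderiv ℝ (v s) x (EuclideanSpace.single 2 1) b = c * fderiv ℝ (v s) x (EuclideanSpace.single b 1) 2 := by
    simpa only [not_eventually, not_not] using hacc
  have hfreq' : ∃ᶠ s in 𝓝[≠] t, ∀ x ∈ ball x₀ ρ, Λ s x = Λ s x₀ := by
    have hnear : ∀ᶠ s in 𝓝[≠] t, s ∈ ball t₀ δ := mem_nhdsWithin_of_mem_nhds (isOpen_ball.mem_nhds ht)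
    exact (hfreq.and_eventually hnear).mono fun s hs => hconst_of_TH s hs.2 hs.1
  have hall := constant_slices_all_of_frequently (convex_ball t₀ δ).isPreconnected hΛan ht hfreq' (mem_ball_self hρ)
  -- `m(s, ·) := Λ(s, x₀)` is a `(t, x₂)`-slope function on the product sub-window
  obtain ⟨z, hz, b, hb, hneq⟩ := hthick (fun s _ => Λ s x₀) (ball t₀ δ ×ˢ ball x₀ ρ) hsub (isOpen_ball.prod isOpen_ball)
    ⟨(t₀, x₀), mem_ball_self hδ, mem_ball_self hρ⟩
  have hzc := hNΛ z.1 hz.1 z.2 hz.2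
  have hΛz : Λ z.1 z.2 = Λ z.1 x₀ := hall z.1 hz.1 z.2 hz.2
  rcases Summit.NavierStokesRegularity.NavierStokesRegularity.Theorems.PoloidalWindowDoorPoloidalWindowRigidityZShockAutonomyPropagation.eq_zero_or_eq_one_of_ne_two hb with rfl | rfl
  · exact hneq (by rw [← hΛz]; exact hzc.1)
  · exact hneq (by rw [← hΛz]; exact hzc.2)

end Summit.NavierStokesRegularity.NavierStokesRegularity.Theorems.PoloidalWindowDoorPoloidalWindowRigidityZShockThickInstants

end
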